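import Summits.ABC.ABC.Theses.DefiniteXi
import Summits.ABC.ABC.Theorems.DefiniteXiFreyModularityIsModular
import Literature.NumberTheory.EllipticCurves.CongruentNumberCurveIsModular
import Literature.NumberTheory.EllipticCurves.LFunctionSmulProofs
import Literature.NumberTheory.DiophantineGeometry.DenesEquationSerreRoadProofs
import HarnessLib

/-!
# Route DefiniteXi, crux `FreyModularity` (stmt-ABC-11340): the CM corner is modular, unconditionally

`FreyModularity` says that every Frey curve `E_(a,b) : y² = x(x − a)(x + b)` (`a ⊥ b`,
`ab(a+b) ≠ 0`) carries a `ModularParametrizationData` at its conductor level; by the landed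
`freyModularity_iff_forall_isModular_freyCurve` (p85939) it is EXACTLY "every Frey curve is
`BCDT.IsModular`" — the Modularity Theorem for the Legendre family up to twist, complete along the
registered line `Sketch` modulo five catalogued XL named facts (Langlands–Tunnell, CDT 7.2.1, 7.2.2,
(3) ⇒ (2) with Carayol, Wiles' 3–5 switch), none discharged in the tree.

This `--supports` file proves the crux ON ITS CM CORNER, unconditionally — the first unconditional
instance of `BCDT.IsModular` for any curve in the tree, and an "inhabited in kind" certificate for the
crux's conclusion (the refuters' audits had to argue the interfaces honest without a single inhabitant):

* `freyCurve_one_one_eq_congruentNumberCurve_one` — `E_(1,1)` IS `E₁ : y² = x³ − x` (same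
  Weierstrass model), the congruent number curve / `X₀(32)` (`j = 1728`, CM by `ℤ[i]`);
* `isNewformOf_freyCurve_one_one` — `φ = η(4z)²η(8z)² ∈ S₂(Γ₀(32))` is the newform of `E_(1,1)`
  (`Literature…Tunnell1983.isNewformOf_congruentNumberCurve_one`: new because `S₂(Γ₀(M)) = 0` for
  `M ∣ 16`, eigen because `dim S₂(Γ₀(32)) = 1`, `a₁ = 1`, and `aₙ(φ) = aₙ(E₁)` for all `n` by the
  tree's Jacobi-sum identity);
* `conductorNorm_freyCurve_one_one` — `N(E_(1,1)) = 32`; `isModular_freyCurve_one_one` —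
  **`BCDT.IsModular (freyCurve 1 1)`**;
* the other two Weierstrass models of the corner, `E_(1,−2) = E_(2,−1) : y² = x(x − 1)(x − 2)` and
  `E_(−1,2) = E_(−2,1) : y² = x(x + 1)(x + 2)`, are the translates `x ↦ x ∓ 1` of `E₁`, so they have
  the same `L`-function (`LFunction_smul`; for `E_(1,−2)` the tree's
  `lFunction_freyCurve_trivial_eq_congruentNumberCurve_one` / `conductorNorm_freyCurve_trivial`) and
  conductor (`conductorNorm_smul_rat`) and the same newform (`isNewformOf_freyCurve_one_neg_two`,
  `isNewformOf_freyCurve_neg_one_two`);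
* `freyModularity_of_natAbs_eq_two` — **the crux's conclusion for every pair `(a, b)` with
  `|ab(a+b)| = 2`**, i.e. for the six Frey curves of the trivial `abc`-triples `1 + 1 = 2` (these are
  exactly `(±1,±1), (±1,∓2), (±2,∓1)`; all are `≅ 32a2`), in the crux's own typing
  `∀ N [NeZero N], N(E_(a,b)) = N → Nonempty (ModularParametrizationData E_(a,b) N)` (via the landed
  `nonempty_modularParametrizationData_iff_isModularAt`: uniformisation, Manin constant and modular
  degree being theorems of the tree).

Nothing here bears on the generic (non-CM) Frey curve: a CM theta series carries no information about
the rest of the family (crux-strategist census s1/s2, Transfer 1–2).  Recorded so that the crux's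
conclusion is known to be inhabited by an honest newform, and so that `BCDT.IsModular` has its first
closed instance.

## References

* J. B. Tunnell, Invent. Math. 72 (1983), p. 325 (`φ = η(4z)²η(8z)²`, the newform of `y² = x³ − x`).
* H. Darmon, L. Merel, J. reine angew. Math. 490 (1997), §4, p. 10 (`X₀(32) : Y² = X³ − X` is the
  Frey curve of the trivial solution).
* C. Breuil, B. Conrad, F. Diamond, R. Taylor, J. Amer. Math. Soc. 14 (2001), Introduction, (2).
-/

-- `Summit.<Summit>.<Problem>` is the mandated summit-side namespace (CONVENTIONS §2); for the
-- single-conjunct summit `ABC` the two coincide, so the duplicate `ABC.ABC` is deliberate.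
set_option linter.dupNamespace false

noncomputable section

open scoped MatrixGroups ModularForm

open CongruenceSubgroup
open Literature.NumberTheory.EllipticCurves
open Literature.NumberTheory.EllipticCurves.ModularForms
open Literature.NumberTheory.EllipticCurves.Tunnell1983
open Literature.NumberTheory.Automorphic
open WeierstrassCurve

namespace Summit.ABC.ABC.Theorems

/-! ### The three Weierstrass models of the CM corner -/

/-- **`E_(1,1)` is the congruent number curve `E₁ : y² = x³ − x`** on the nose:
`y² = x(x − 1)(x + 1) = x³ − x` (`a₂ = b − a = 0`, `a₄ = −ab = −1`). [folklore] -/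
theorem freyCurve_one_one_eq_congruentNumberCurve_one : freyCurve 1 1 = congruentNumberCurve 1 := by
  ext <;> simp [freyCurve, congruentNumberCurve]

/-- `E_(−1,−1) = E₁` as well (`y² = x(x + 1)(x − 1)`). [folklore] -/
theorem freyCurve_neg_one_neg_one_eq_congruentNumberCurve_one :
    freyCurve (-1) (-1) = congruentNumberCurve 1 := by
  ext <;> simp [freyCurve, congruentNumberCurve]

/-- `E_(2,−1) = E_(1,−2)` (`y² = x(x − 2)(x − 1) = x(x − 1)(x − 2)`: same Weierstrass model). [folklore] -/
theorem freyCurve_two_neg_one_eq : freyCurve 2 (-1) = freyCurve 1 (-2) := by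
  ext <;> norm_num [freyCurve]

/-- `E_(−2,1) = E_(−1,2)` (`y² = x(x + 2)(x + 1) = x(x + 1)(x + 2)`). [folklore] -/
theorem freyCurve_neg_two_one_eq : freyCurve (-2) 1 = freyCurve (-1) 2 := by
  ext <;> norm_num [freyCurve]

/-- `E_(−1,2) : y² = x(x + 1)(x + 2)` is the translate `x ↦ x + 1` of `E₁ : y² = x³ − x`
(variable change `(u, r, s, t) = (1, 1, 0, 0)` applied to `E₁`). [folklore] -/
theorem freyCurve_neg_one_two_eq_smul :
    freyCurve (-1) 2 = (⟨1, 1, 0, 0⟩ : VariableChange ℚ) • congruentNumberCurve 1 := by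
  ext <;> simp [freyCurve, congruentNumberCurve, variableChange_def] <;> norm_num

/-! ### `E_(1,1)`: newform, conductor, modularity -/

/-- **`φ = η(4z)²η(8z)²` is the newform of the Frey curve `E_(1,1)`**: `IsNewformOf (freyCurve 1 1) φ`
at level `32` (`E_(1,1) = E₁` and `Tunnell1983.isNewformOf_congruentNumberCurve_one`).
[cite: Tunnell1983Congruent, p. 325] -/
theorem isNewformOf_freyCurve_one_one : IsNewformOf (freyCurve 1 1) congruentCuspForm32 := by
  rw [freyCurve_one_one_eq_congruentNumberCurve_one]
  exact isNewformOf_congruentNumberCurve_one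

/-- **`N(E_(1,1)) = 32`.** [cite: DarmonMerel1997, Prop. 1.1 (1)] -/
theorem conductorNorm_freyCurve_one_one : (freyCurve 1 1).conductorNorm ℤ = 32 := by
  rw [freyCurve_one_one_eq_congruentNumberCurve_one]
  exact conductorNorm_congruentNumberCurve_one

/-- **The Frey curve `E_(1,1) : y² = x³ − x` is modular** (`BCDT.IsModular`, condition (2) of
Breuil–Conrad–Diamond–Taylor: a newform on `Γ₀(N(E))` with `aₙ(f) = aₙ(E)` for all `n`) —
unconditionally; the instance `NeZero (N(E_(1,1)))` is quantified as in the crux.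
[cite: BCDTJAMS2001, Introduction, condition (2)] -/
theorem isModular_freyCurve_one_one [NeZero ((freyCurve 1 1).conductorNorm ℤ)] :
    BCDT.IsModular (freyCurve 1 1) := by
  have key : ∀ (N : ℕ) [NeZero N], (freyCurve 1 1).conductorNorm ℤ = N →
      ∃ f : CuspForm (Gamma0 N) 2, IsNewformOf (freyCurve 1 1) f := by
    intro N _ hN
    rw [conductorNorm_freyCurve_one_one] at hN
    subst hN
    exact ⟨congruentCuspForm32, isNewformOf_freyCurve_one_one⟩
  exact key _ rfl

/-! ### The translated models `E_(1,−2)`, `E_(−1,2)` -/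

-- `E_(1,−2) : y² = x(x − 1)(x − 2)`: its `L`-function and conductor are the tree's
-- `lFunction_freyCurve_trivial_eq_congruentNumberCurve_one` and `conductorNorm_freyCurve_trivial`
-- (`DenesEquationSerreRoadProofs`, the Frey curve of the trivial solution of `x + y = 2z`).

/-- `φ` is the newform of `E_(1,−2)`. [cite: Tunnell1983Congruent, p. 325] -/
theorem isNewformOf_freyCurve_one_neg_two : IsNewformOf (freyCurve 1 (-2)) congruentCuspForm32 :=
  ⟨isNewform0_congruentCuspForm32, fun n ↦ by
    rw [Literature.NumberTheory.DiophantineGeometry.lFunction_freyCurve_trivial_eq_congruentNumberCurve_one]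
    exact cuspCoeff_congruentCuspForm32_eq_lFunction n⟩

/-- `E_(−1,2) : y² = x(x + 1)(x + 2)` has the `L`-function of `E₁`. [folklore] -/
theorem lFunction_freyCurve_neg_one_two :
    (freyCurve (-1) 2).LFunction = (congruentNumberCurve 1).LFunction := by
  haveI := isElliptic_congruentNumberCurve_one
  rw [freyCurve_neg_one_two_eq_smul, LFunction_smul]

/-- `N(E_(−1,2)) = 32`. [cite: DarmonMerel1997, Prop. 1.1 (1)] -/
theorem conductorNorm_freyCurve_neg_one_two : (freyCurve (-1) 2).conductorNorm ℤ = 32 := by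
  haveI := isElliptic_congruentNumberCurve_one
  rw [freyCurve_neg_one_two_eq_smul, conductorNorm_smul_rat, conductorNorm_congruentNumberCurve_one]

/-- `φ` is the newform of `E_(−1,2)`. [cite: Tunnell1983Congruent, p. 325] -/
theorem isNewformOf_freyCurve_neg_one_two : IsNewformOf (freyCurve (-1) 2) congruentCuspForm32 :=
  ⟨isNewform0_congruentCuspForm32, fun n ↦ by
    rw [lFunction_freyCurve_neg_one_two]; exact cuspCoeff_congruentCuspForm32_eq_lFunction n⟩

/-! ### The crux on its CM corner -/

/-- The pairs `(a, b)` with `|ab(a+b)| = 2` are exactly the six pairs of the trivial `abc`-triples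
`1 + 1 = 2`: `(1,1), (−1,−1), (1,−2), (2,−1), (−1,2), (−2,1)`. [folklore] -/
theorem eq_of_natAbs_mul_mul_add_eq_two {a b : ℤ} (h2 : (a * b * (a + b)).natAbs = 2) :
    (a = 1 ∧ b = 1) ∨ (a = -1 ∧ b = -1) ∨ (a = 1 ∧ b = -2) ∨ (a = 2 ∧ b = -1) ∨
      (a = -1 ∧ b = 2) ∨ (a = -2 ∧ b = 1) := by
  have ha : a.natAbs ∣ 2 := by
    rw [← h2, Int.natAbs_mul, Int.natAbs_mul]
    exact Dvd.dvd.mul_right (dvd_mul_right _ _) _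
  have hb : b.natAbs ∣ 2 := by
    rw [← h2, Int.natAbs_mul, Int.natAbs_mul]
    exact Dvd.dvd.mul_right (dvd_mul_left _ _) _
  have ha2 : a.natAbs ≤ 2 := Nat.le_of_dvd two_pos ha
  have hb2 : b.natAbs ≤ 2 := Nat.le_of_dvd two_pos hb
  have ha' : -2 ≤ a ∧ a ≤ 2 := by omega
  have hb' : -2 ≤ b ∧ b ≤ 2 := by omega
  obtain ⟨ha1, ha3⟩ := ha'
  obtain ⟨hb1, hb3⟩ := hb'
  interval_cases a <;> interval_cases b <;> simp_all

/-- **At the CM corner, every Frey curve has the newform `φ` at level `32 = N(E)`**: for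
`|ab(a+b)| = 2`, `N(E_(a,b)) = 32` and `IsNewformOf (freyCurve a b) φ`. [cite: Tunnell1983Congruent, p. 325] -/
theorem conductorNorm_eq_and_isNewformOf_of_natAbs_eq_two {a b : ℤ}
    (h2 : (a * b * (a + b)).natAbs = 2) :
    (freyCurve a b).conductorNorm ℤ = 32 ∧ IsNewformOf (freyCurve a b) congruentCuspForm32 := by
  rcases eq_of_natAbs_mul_mul_add_eq_two h2 with ⟨rfl, rfl⟩ | ⟨rfl, rfl⟩ | ⟨rfl, rfl⟩ |
      ⟨rfl, rfl⟩ | ⟨rfl, rfl⟩ | ⟨rfl, rfl⟩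
  · exact ⟨conductorNorm_freyCurve_one_one, isNewformOf_freyCurve_one_one⟩
  · rw [freyCurve_neg_one_neg_one_eq_congruentNumberCurve_one]
    exact ⟨conductorNorm_congruentNumberCurve_one, isNewformOf_congruentNumberCurve_one⟩
  · exact ⟨Literature.NumberTheory.DiophantineGeometry.conductorNorm_freyCurve_trivial,
      isNewformOf_freyCurve_one_neg_two⟩
  · rw [freyCurve_two_neg_one_eq]
    exact ⟨Literature.NumberTheory.DiophantineGeometry.conductorNorm_freyCurve_trivial,
      isNewformOf_freyCurve_one_neg_two⟩
  · exact ⟨conductorNorm_freyCurve_neg_one_two, isNewformOf_freyCurve_neg_one_two⟩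
  · rw [freyCurve_neg_two_one_eq]
    exact ⟨conductorNorm_freyCurve_neg_one_two, isNewformOf_freyCurve_neg_one_two⟩

/-- **`FreyModularity` holds on its CM corner, unconditionally.**  For every pair `(a, b)` with
`|ab(a+b)| = 2` — the Frey curves of the trivial `abc`-triples `1 + 1 = 2`, all isomorphic to
`32a2 : y² = x³ − x` — the crux's own conclusion holds: at every level `N = N(E_(a,b))` (`= 32`)
there is a `ModularParametrizationData` for `E_(a,b)`, i.e. (by the landed
`nonempty_modularParametrizationData_iff_isModularAt`: uniformisation, Manin constant and modular
degree are theorems of the tree) a newform of `E_(a,b)` on `Γ₀(N)`, namely `φ = η(4z)²η(8z)²`.  This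
is the body of `Summit.ABC.ABC.Theses.DefiniteXi.FreyModularity` at these `(a, b)` (they are coprime
with `ab(a+b) ≠ 0`), proved without any modularity hypothesis. [cite: Tunnell1983Congruent, p. 325] -/
theorem freyModularity_of_natAbs_eq_two :
    ∀ {a b : ℤ}, (a * b * (a + b)).natAbs = 2 → ∀ (N : ℕ) [NeZero N],
      (freyCurve a b).conductorNorm ℤ = N → Nonempty (ModularParametrizationData (freyCurve a b) N) := by
  intro a b h2 N _ hN
  have h0 : a * b * (a + b) ≠ 0 := by
    intro h; rw [h] at h2; simp at h2
  haveI := isElliptic_freyCurve h0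
  obtain ⟨h32, hφ⟩ := conductorNorm_eq_and_isNewformOf_of_natAbs_eq_two h2
  rw [h32] at hN
  subst hN
  exact (nonempty_modularParametrizationData_iff_isModularAt (freyCurve a b) 32).mpr ⟨_, hφ⟩

/-- **Every Frey curve of the CM corner is `BCDT.IsModular`** (the conclusion of the landed iff
`freyModularity_iff_forall_isModular_freyCurve`, at `|ab(a+b)| = 2`). [cite: BCDTJAMS2001, Introduction, condition (2)] -/
theorem isModular_freyCurve_of_natAbs_eq_two {a b : ℤ} (h2 : (a * b * (a + b)).natAbs = 2)
    [NeZero ((freyCurve a b).conductorNorm ℤ)] : BCDT.IsModular (freyCurve a b) := by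
  have h0 : a * b * (a + b) ≠ 0 := by
    intro h; rw [h] at h2; simp at h2
  haveI := isElliptic_freyCurve h0
  exact (nonempty_modularParametrizationData_iff_isModularAt (freyCurve a b) _).mp
    (freyModularity_of_natAbs_eq_two h2 _ rfl)

/-! ### Residual modularity on the CM corner (appended by lead c51, same seat)

BCDT's (2) ⇒ (4) (`IsModular.isModular_of_isTorsionGaloisRep''`, proved in the tree with the
discharged trace fact `trace_galoisRepTate_frobenius_of_hasGoodReductionAt_holds`) turns the
modularity of the CM corner into the modularity of every residual representation `ρ̄_{E,ℓ}` — the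
first unconditional instances of `ModPGaloisRep.IsModular` for representations coming from a curve,
i.e. of the CONCLUSION shape of the line's atom `stub_modThree` (there: `ρ̄_{E,3}` of any `E/ℚ`
with `ρ̄` absolutely irreducible, by Langlands–Tunnell). -/

open Literature.NumberTheory.GaloisRepresentations

/-- **Every framed `ρ̄_{E,ℓ}` of a CM-corner Frey curve is modular** (`ModPGaloisRep.IsModular`:
`ρ̄ ∼ ρ̄_{g,λ}` for a newform `g` — here `g = φ = η(4z)²η(8z)²`), for every prime `ℓ` and every
pair `(a, b)` with `|ab(a+b)| = 2`, unconditionally: `E_(a,b)` is `BCDT.IsModular`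
(`isModular_freyCurve_of_natAbs_eq_two`) and (2) ⇒ (4) is the tree's
`IsModular.isModular_of_isTorsionGaloisRep''`. [cite: BCDTJAMS2001, Introduction ((2) ⇒ (4))] -/
theorem isModular_modPGaloisRep_freyCurve_of_natAbs_eq_two {a b : ℤ}
    (h2 : (a * b * (a + b)).natAbs = 2) {ℓ : ℕ} [Fact ℓ.Prime] {ρ : ModPGaloisRep ℚ (ZMod ℓ) 2}
    (hρ : (freyCurve a b).IsTorsionGaloisRep ℓ ρ) : ρ.IsModular := by
  have h0 : a * b * (a + b) ≠ 0 := by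
    intro h; rw [h] at h2; simp at h2
  haveI := isElliptic_freyCurve h0
  haveI : NeZero ((freyCurve a b).conductorNorm ℤ) := ⟨(conductorNorm_pos_holds _).ne'⟩
  exact (isModular_freyCurve_of_natAbs_eq_two h2).isModular_of_isTorsionGaloisRep'' hρ

/-- In particular **`ρ̄_{E₁,3}` is modular** for `E₁ = E_(1,1) : y² = x³ − x` and every framed model
`ρ̄` of `E₁[3]` — an unconditional instance of the conclusion of atom S1a (`stub_modThree`) of line
`Sketch`. [cite: BCDTJAMS2001, Introduction ((2) ⇒ (4))] -/
theorem isModular_modThree_freyCurve_one_one {ρ : ModPGaloisRep ℚ (ZMod 3) 2}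
    (hρ : (freyCurve 1 1).IsTorsionGaloisRep 3 ρ) : ρ.IsModular :=
  isModular_modPGaloisRep_freyCurve_of_natAbs_eq_two (a := 1) (b := 1) (by norm_num) hρ

end Summit.ABC.ABC.Theorems

end
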